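import Summits.HubbardSuperconductivity.HubbardSuperconductivity.Theses.WeakCouplingBCS
import Literature.MathematicalPhysics.QuantumLattice.FinDimSpectrum

/-!
# Crux `WcbcsSsbToTorusLRO` (item `stmt-HubbardSuperconductivity-2009`): the FORWARD Koma–Tasaki direction is not
abstract either — negative-side support from the standing disprover (generation 5), small-model facts, file 2 of 2

Companion of `AbstractConverseFalse.lean` (file 1 of 2; self-contained, no import between the two). Here: `not_abstractForward` — a `ℂ²` family
(`H_V = diag(0, V²)`, `N = diag(2, 0)`, `P_V = V|e₁⟩⟨e₀|`, local notation) whose ground states all have FULL pair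
order `⟨P†P⟩ = V²` while the sourced chord `E(H_V) - E(H_V - h(P_V + P_V†))` is `≤ 1` for all `0 < h ≤ 1`, uniformly
in `V` (`af_chord_le_one`): no volume-uniform linear budget `2hcV - B` fits under it, i.e. Koma–Tasaki's forward
theorem `m ≥ √2 o μ₂` [Koma–Tasaki 1994, §0.7 and Theorem 2.2] genuinely spends the double-commutator (locality)
budget `|⟨[[O,H],O]⟩| ≤ 4r²ho²N` (tree: `Literature.MathematicalPhysics.QuantumLattice.KomaTasaki.horschVonDerLinden_holds`),
violated by the toy (`⟨e₀, [[P+P†, H], P+P†] e₀⟩ = 2V⁴`). Workfile: `Cruxes/WcbcsSsbToTorusLRO/DisproofRound2.lean` §17.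
Elementary linear algebra. [folklore]
-/

noncomputable section

namespace Summit.HubbardSuperconductivity.WcbcsSsbToTorusLRO.Negative

open Matrix

/-- Forward toy Hamiltonian `diag(0, V²)` on `ℂ²`. -/
local notation "afH[" V "]" => (Matrix.diagonal ![(0 : ℂ), (((V : ℝ) ^ 2 : ℝ) : ℂ)] : Matrix (Fin 2) (Fin 2) ℂ)
/-- Forward toy number operator `diag(2, 0)`. -/
local notation "afN" => (Matrix.diagonal ![(2 : ℂ), 0] : Matrix (Fin 2) (Fin 2) ℂ)
/-- Forward toy pair annihilator `V |e₁⟩⟨e₀|`. -/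
local notation "afP[" V "]" => (Matrix.of ![![(0 : ℂ), 0], ![((V : ℝ) : ℂ), 0]] : Matrix (Fin 2) (Fin 2) ℂ)

/-! ### Variational bookkeeping (restated, as in file 1; five lines) -/

/-- `re ⟨ψ, A ψ⟩ ≥ -Σ_{s,t} |A_{st}|` for a unit vector. [folklore] -/
theorem neg_sum_norm_le_rayleigh₂ {n : Type*} [Fintype n] (A : Matrix n n ℂ) {ψ : n → ℂ} (hψ : star ψ ⬝ᵥ ψ = 1) :
    -(∑ s, ∑ t, ‖A s t‖) ≤ (star ψ ⬝ᵥ A *ᵥ ψ).re := by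
  have hcomp : ∀ s, ‖ψ s‖ ≤ 1 := by
    intro s
    have h1 : ‖ψ s‖ ^ 2 ≤ ∑ t, ‖ψ t‖ ^ 2 :=
      Finset.single_le_sum (fun t _ => sq_nonneg (‖ψ t‖)) (Finset.mem_univ s)
    have h2 : (∑ t, ‖ψ t‖ ^ 2 : ℝ) = 1 := by
      have := congrArg Complex.re hψ
      rw [dotProduct, Complex.re_sum] at this
      simp only [Pi.star_apply, Complex.star_def, Complex.conj_mul', Complex.one_re] at this
      rw [← this]
      refine Finset.sum_congr rfl fun t _ => ?_
      norm_cast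
    rw [h2] at h1
    nlinarith [norm_nonneg (ψ s)]
  have hbound : ‖star ψ ⬝ᵥ A *ᵥ ψ‖ ≤ ∑ s, ∑ t, ‖A s t‖ := by
    rw [dotProduct]
    refine (norm_sum_le _ _).trans (Finset.sum_le_sum fun s _ => ?_)
    rw [Pi.star_apply, norm_mul, norm_star, Matrix.mulVec, dotProduct]
    refine (mul_le_of_le_one_left (norm_nonneg _) (hcomp s)).trans ?_
    refine (norm_sum_le _ _).trans (Finset.sum_le_sum fun t _ => ?_)
    rw [norm_mul]
    exact mul_le_of_le_one_right (norm_nonneg _) (hcomp t)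
  have := Complex.abs_re_le_norm (star ψ ⬝ᵥ A *ᵥ ψ)
  rw [abs_le] at this
  linarith [this.1]

/-- The Rayleigh set of `A` on unit vectors of `K` is bounded below. [folklore] -/
theorem bddBelow_rayleigh₂ {n : Type*} [Fintype n] (A : Matrix n n ℂ) (K : Submodule ℂ (n → ℂ)) :
    BddBelow {E : ℝ | ∃ ψ ∈ K, star ψ ⬝ᵥ ψ = 1 ∧ E = (star ψ ⬝ᵥ A *ᵥ ψ).re} := by
  refine ⟨-(∑ s, ∑ t, ‖A s t‖), ?_⟩
  rintro E ⟨ψ, -, hψ, rfl⟩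
  exact neg_sum_norm_le_rayleigh₂ A hψ

/-- Variational principle in a sector: `minEnergyOn A K ≤ re ⟨ψ, A ψ⟩` for unit `ψ ∈ K`. [folklore] -/
theorem minEnergyOn_le_rayleigh₂ {n : Type*} [Fintype n] (A : Matrix n n ℂ) (K : Submodule ℂ (n → ℂ))
    {ψ : n → ℂ} (hψK : ψ ∈ K) (hψ : star ψ ⬝ᵥ ψ = 1) : A.minEnergyOn K ≤ (star ψ ⬝ᵥ A *ᵥ ψ).re :=
  csInf_le (bddBelow_rayleigh₂ A K) ⟨ψ, hψK, hψ, rfl⟩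

/-! ### The forward direction -/

/-- Action of the forward toy Hamiltonian. [folklore] -/
theorem afH_mulVec (V : ℝ) (ψ : Fin 2 → ℂ) : afH[V] *ᵥ ψ = ![0, ((V ^ 2 : ℝ) : ℂ) * ψ 1] := by
  ext i
  fin_cases i <;> simp [Matrix.mulVec_diagonal]

/-- Action of the forward toy pair annihilator. [folklore] -/
theorem afP_mulVec (V : ℝ) (ψ : Fin 2 → ℂ) : afP[V] *ᵥ ψ = ![0, (V : ℂ) * ψ 0] := by
  ext i
  fin_cases i <;> simp [Matrix.mulVec, dotProduct, Fin.sum_univ_two]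

/-- Adjoint of the forward toy pair annihilator. [folklore] -/
theorem afP_conjTranspose (V : ℝ) : afP[V]ᴴ = Matrix.of ![![0, (V : ℂ)], ![0, 0]] := by
  ext i j
  fin_cases i <;> fin_cases j <;> simp [Matrix.conjTranspose_apply]

/-- Action of the adjoint pair operator (forward toy). [folklore] -/
theorem afPH_mulVec (V : ℝ) (ψ : Fin 2 → ℂ) : afP[V]ᴴ *ᵥ ψ = ![(V : ℂ) * ψ 1, 0] := by
  rw [afP_conjTranspose]
  ext i
  fin_cases i <;> simp [Matrix.mulVec, dotProduct, Fin.sum_univ_two]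

/-- Action of the pair intensity `P†P` (forward toy). [folklore] -/
theorem afPHP_mulVec (V : ℝ) (ψ : Fin 2 → ℂ) : (afP[V]ᴴ * afP[V]) *ᵥ ψ = ![(V : ℂ) * ((V : ℂ) * ψ 0), 0] := by
  rw [← Matrix.mulVec_mulVec, afP_mulVec, afPH_mulVec]
  ext i
  fin_cases i <;> simp

/-- The forward toy Hamiltonian is Hermitian. [folklore] -/
theorem afH_isHermitian (V : ℝ) : afH[V].IsHermitian := by
  unfold Matrix.IsHermitian
  ext i j
  fin_cases i <;> fin_cases j <;> simp [Matrix.conjTranspose_apply, Matrix.diagonal, Complex.conj_ofReal]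

/-- The forward toy number operator is Hermitian. [folklore] -/
theorem afN_isHermitian : (afN).IsHermitian := by
  unfold Matrix.IsHermitian
  ext i j
  fin_cases i <;> fin_cases j <;> simp [Matrix.conjTranspose_apply, Matrix.diagonal]

/-- Number conservation in the forward toy. [folklore] -/
theorem afH_comm_afN (V : ℝ) : afH[V] * afN = afN * afH[V] := by
  simp [Matrix.diagonal_mul_diagonal, mul_comm]

/-- `P_V` lowers the number by two (forward toy). [folklore] -/
theorem afN_comm_afP (V : ℝ) : afN * afP[V] - afP[V] * afN = -((2 : ℂ) • afP[V]) := by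
  ext i j
  simp only [Matrix.sub_apply, Matrix.diagonal_mul, Matrix.mul_diagonal, Matrix.neg_apply,
    Matrix.smul_apply, smul_eq_mul]
  fin_cases i <;> fin_cases j <;> simp
  ring

/-- `re ⟨ψ, ψ⟩ = Σ |ψ i|²` on `ℂ²`. [folklore] -/
theorem re_star_self₂ (ψ : Fin 2 → ℂ) : (star ψ ⬝ᵥ ψ).re = ‖ψ 0‖ ^ 2 + ‖ψ 1‖ ^ 2 := by
  rw [Complex.sq_norm, Complex.sq_norm, Complex.normSq_apply, Complex.normSq_apply]
  simp [dotProduct, Fin.sum_univ_two, Complex.mul_re]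

/-- `re⟨ψ, H_V ψ⟩ = V² |ψ 1|²`. [folklore] -/
theorem re_rayleigh_afH (V : ℝ) (ψ : Fin 2 → ℂ) : (star ψ ⬝ᵥ afH[V] *ᵥ ψ).re = V ^ 2 * ‖ψ 1‖ ^ 2 := by
  have hre : ((V : ℂ) ^ 2).re = V ^ 2 := by rw [← Complex.ofReal_pow, Complex.ofReal_re]
  have him : ((V : ℂ) ^ 2).im = 0 := by rw [← Complex.ofReal_pow, Complex.ofReal_im]
  rw [afH_mulVec, Complex.sq_norm, Complex.normSq_apply]
  simp [dotProduct, Fin.sum_univ_two, Complex.mul_re, Complex.mul_im, hre, him]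
  ring

/-- `re⟨ψ, P†P ψ⟩ = V² |ψ 0|²`. [folklore] -/
theorem re_rayleigh_afPHP (V : ℝ) (ψ : Fin 2 → ℂ) :
    (star ψ ⬝ᵥ (afP[V]ᴴ * afP[V]) *ᵥ ψ).re = V ^ 2 * ‖ψ 0‖ ^ 2 := by
  rw [afPHP_mulVec, Complex.sq_norm, Complex.normSq_apply]
  simp [dotProduct, Fin.sum_univ_two, Complex.mul_re, Complex.mul_im]
  ring

/-- `re⟨ψ, (P + Pᴴ) ψ⟩ = 2V re(conj(ψ 1) ψ 0)`. [folklore] -/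
theorem re_rayleigh_afSource (V : ℝ) (ψ : Fin 2 → ℂ) :
    (star ψ ⬝ᵥ (afP[V] + afP[V]ᴴ) *ᵥ ψ).re = 2 * V * ((starRingEnd ℂ) (ψ 1) * ψ 0).re := by
  rw [Matrix.add_mulVec, afP_mulVec, afPH_mulVec]
  simp [dotProduct, Fin.sum_univ_two, Complex.mul_re, Complex.mul_im]
  ring

/-- The sourced Rayleigh quotient of the forward toy. [folklore] -/
theorem re_rayleigh_afSourced (V h : ℝ) (ψ : Fin 2 → ℂ) :
    (star ψ ⬝ᵥ (afH[V] - (h : ℂ) • (afP[V] + afP[V]ᴴ)) *ᵥ ψ).re =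
      V ^ 2 * ‖ψ 1‖ ^ 2 - 2 * h * V * ((starRingEnd ℂ) (ψ 1) * ψ 0).re := by
  rw [Matrix.sub_mulVec, dotProduct_sub, Complex.sub_re, Matrix.smul_mulVec, dotProduct_smul, smul_eq_mul,
    Complex.re_ofReal_mul, re_rayleigh_afH, re_rayleigh_afSource]
  ring

/-- `E(H_V) = 0`. [folklore] -/
theorem minEnergyOn_afH (V : ℝ) : afH[V].minEnergyOn ⊤ = 0 := by
  apply le_antisymm
  · have h := minEnergyOn_le_rayleigh₂ afH[V] ⊤ (ψ := ![1, 0]) Submodule.mem_top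
      (by simp [dotProduct, Fin.sum_univ_two])
    rw [re_rayleigh_afH] at h
    simpa using h
  · refine le_csInf ⟨_, ![1, 0], Submodule.mem_top, by simp [dotProduct, Fin.sum_univ_two], rfl⟩ ?_
    rintro E ⟨ψ, -, -, rfl⟩
    rw [re_rayleigh_afH]
    positivity

/-- The toy's ground states have FULL pair order: `Hψ = E(H)ψ`, `‖ψ‖ = 1`, `V ≠ 0 ⇒ ⟨ψ, P†Pψ⟩ = V²`. [folklore] -/
theorem af_groundState_lro {V : ℝ} (hV : V ≠ 0) {ψ : Fin 2 → ℂ} (hψ : star ψ ⬝ᵥ ψ = 1)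
    (hGS : afH[V] *ᵥ ψ = ((afH[V].minEnergyOn ⊤ : ℝ) : ℂ) • ψ) :
    (star ψ ⬝ᵥ (afP[V]ᴴ * afP[V]) *ᵥ ψ).re = V ^ 2 := by
  rw [minEnergyOn_afH, afH_mulVec] at hGS
  have h1 : ψ 1 = 0 := by
    have := congrFun hGS 1
    simp at this
    aesop
  have hu : ‖ψ 0‖ ^ 2 + ‖ψ 1‖ ^ 2 = 1 := by rw [← re_star_self₂, hψ, Complex.one_re]
  rw [h1, norm_zero] at hu
  rw [re_rayleigh_afPHP]
  nlinarith [hu]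

/-- `P_V† P_V ≤ V²`. [folklore] -/
theorem afPHP_le (V : ℝ) (φ : Fin 2 → ℂ) :
    (star φ ⬝ᵥ (afP[V]ᴴ * afP[V]) *ᵥ φ).re ≤ V ^ 2 * (star φ ⬝ᵥ φ).re := by
  rw [re_rayleigh_afPHP, re_star_self₂]
  nlinarith [sq_nonneg ‖φ 1‖, sq_nonneg V, mul_nonneg (sq_nonneg V) (sq_nonneg ‖φ 1‖)]

/-- **The sourced toy gains at most `1`**: for `0 ≤ h ≤ 1` and `0 ≤ V`, `E(H_V - h(P_V + P_Vᴴ)) ≥ -1`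
(`V²x² - 2Vx ≥ -1`), so the chord is `≤ 1` uniformly in `V` — no sourced order density at all. [folklore] -/
theorem minEnergyOn_afSourced_ge {V h : ℝ} (hV : 0 ≤ V) (h0 : 0 ≤ h) (hh : h ≤ 1) :
    -1 ≤ (afH[V] - (h : ℂ) • (afP[V] + afP[V]ᴴ)).minEnergyOn ⊤ := by
  refine le_csInf ⟨_, ![1, 0], Submodule.mem_top, by simp [dotProduct, Fin.sum_univ_two], rfl⟩ ?_
  rintro E ⟨ψ, -, hψ, rfl⟩
  rw [re_rayleigh_afSourced]
  have hre : ((starRingEnd ℂ) (ψ 1) * ψ 0).re ≤ ‖ψ 1‖ * ‖ψ 0‖ := by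
    refine (Complex.re_le_norm _).trans (le_of_eq ?_)
    rw [norm_mul, RCLike.norm_conj]
  have hu : ‖ψ 0‖ ^ 2 + ‖ψ 1‖ ^ 2 = 1 := by rw [← re_star_self₂, hψ, Complex.one_re]
  have h0le : ‖ψ 0‖ ≤ 1 := by nlinarith [norm_nonneg (ψ 0), norm_nonneg (ψ 1)]
  have hx : ((starRingEnd ℂ) (ψ 1) * ψ 0).re ≤ ‖ψ 1‖ :=
    hre.trans (mul_le_of_le_one_right (norm_nonneg _) h0le)
  have hhV : 0 ≤ h * V := mul_nonneg h0 hV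
  nlinarith [sq_nonneg (V * ‖ψ 1‖ - 1), mul_le_mul_of_nonneg_left hx (by positivity : (0:ℝ) ≤ 2 * h * V),
    mul_le_mul_of_nonneg_right hh (mul_nonneg hV (norm_nonneg (ψ 1))), norm_nonneg (ψ 1)]

/-- The sourced chord of the forward toy is at most `1` for `0 ≤ h ≤ 1`. [folklore] -/
theorem af_chord_le_one {V h : ℝ} (hV : 0 ≤ V) (h0 : 0 ≤ h) (hh : h ≤ 1) :
    afH[V].minEnergyOn ⊤ - (afH[V] - (h : ℂ) • (afP[V] + afP[V]ᴴ)).minEnergyOn ⊤ ≤ 1 := by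
  rw [minEnergyOn_afH]
  have := minEnergyOn_afSourced_ge hV h0 hh
  linarith

/-- **¬ AbstractForward**: the family `(H_V, N, P_V)` has full ground-state pair order `σ = 1` at every volume,
yet its sourced chord is `≤ 1` for all `h ≤ 1` — no volume-uniform budget `2hcV - B` fits under it. [folklore] -/
theorem not_abstractForward : ¬ (
  ∀ (n : Type) [Fintype n] [DecidableEq n] (H N P : ℝ → Matrix n n ℂ) (σ : ℝ), 0 < σ →
    (∀ V : ℝ, 1 ≤ V →
      (H V).IsHermitian ∧ (N V).IsHermitian ∧ H V * N V = N V * H V ∧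
        N V * P V - P V * N V = -((2 : ℂ) • P V) ∧
        (∀ φ : n → ℂ, (star φ ⬝ᵥ ((P V)ᴴ * P V) *ᵥ φ).re ≤ V ^ 2 * (star φ ⬝ᵥ φ).re) ∧
        (∀ ψ : n → ℂ, star ψ ⬝ᵥ ψ = 1 → H V *ᵥ ψ = (((H V).minEnergyOn ⊤ : ℝ) : ℂ) • ψ →
          σ ^ 2 * V ^ 2 ≤ (star ψ ⬝ᵥ ((P V)ᴴ * P V) *ᵥ ψ).re)) →
    ∃ c B : ℝ, 0 < c ∧ ∀ V h : ℝ, 1 ≤ V → 0 < h → h ≤ 1 →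
      2 * h * c * V - B ≤ (H V).minEnergyOn ⊤ - (H V - (h : ℂ) • (P V + (P V)ᴴ)).minEnergyOn ⊤) := by
  intro hF
  obtain ⟨c, B, hc, hcB⟩ := hF (Fin 2) (fun V => afH[V]) (fun _ => afN) (fun V => afP[V]) 1 one_pos (fun V hV =>
    ⟨afH_isHermitian V, afN_isHermitian, afH_comm_afN V, afN_comm_afP V, afPHP_le V,
      fun ψ hψ hGS => by
        rw [af_groundState_lro (by positivity) hψ hGS, one_pow, one_mul]⟩)
  set V : ℝ := (|B| + 2) / (2 * c) + 1 with hVdef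
  have hV1 : 1 ≤ V := by
    have : 0 ≤ (|B| + 2) / (2 * c) := by positivity
    linarith
  have h1 := hcB V 1 hV1 one_pos le_rfl
  have h2 := af_chord_le_one (V := V) (h := 1) (by linarith) zero_le_one le_rfl
  have h3 : 2 * c * V = |B| + 2 + 2 * c := by
    rw [hVdef, mul_add, mul_one, mul_div_cancel₀ _ (by positivity : (2 * c) ≠ 0)]
  have h4 : B ≤ |B| := le_abs_self B
  linarith [h1, h2, h3, h4, hc]


end Summit.HubbardSuperconductivity.WcbcsSsbToTorusLRO.Negative

end
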